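import Literature.Probability.FitznerVanDerHofstad2017.SrwTwistBesselRow
import HarnessLib

/-!
# Weighted twisted seeds: linearity in the weight and the product-weight Schwinger–Fubini form

The consumer interface of the separable trigonometric majorant (`srwK_le_gset`, `srwU_le_gset`,
`srwKM2_le_of_trigMajorant`) prices `K_{n,l}`, `U_{n,l}`, `KM₂` by the twisted moments
`srwTwist d n w x β = ∫ w(k) cos(β D̂^{(x)}_sym(k)) Ĉ(k)ⁿ dk/(2π)^d` with the WEIGHTS `w = |D̂|^l`,
`|D̂|^l D̂^{sin}`, `|D̂|^l M̂²`.  For even `l` (and after the usual polynomial majorisation for odd `l`)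
these weights are finite linear combinations of PRODUCT weights `k ↦ ∏_μ g_μ(k_μ)` of one-coordinate
trigonometric monomials (`cos^a`, `sin² = 1 - cos²`).  This file supplies the two d-generic identities that
reduce such weighted twisted seeds at an axis node `x = m e_i` to ONE-COORDINATE INSERTED ROWS
(`SrwTwistInsertedRow.lean`):

* `srwTwist_sum_weight` — `srwTwist` is linear in the weight (finite sums of bounded measurable weights,
  `d ≥ 2n + 1`; integrability from the tree's `integrable_weight_cos_mul_Chat_pow`);
* `integral_prod_mul_cexp_Dhat_add_P`, `integral_prod_mul_exp_Dhat_mul_cos_P` — Fubini on the cube with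
  a product weight: `∫ (∏_μ g_μ(k_μ)) e^{τD̂(k)} cos(β Σ_j cos(m k_j)) dk = Re ∏_μ T^{g_μ}_m(τ/d, β)` with the
  inserted one-coordinate transforms `T^{g}_m(v, y) = ∫_{[-π,π]} g(t) e^{v cos t + iy cos(mt)} dt`;
* `srwTwist_succ_prod_single_eq_integral` — the Schwinger / axis-transform form of a product-weighted
  twisted seed: for `d ≥ 2n + 3`, `|g_μ| ≤ 1` continuous,
  `srwTwist d (n+1) (∏_μ g_μ) (m e_i) β = (n!)⁻¹ (∫₀^∞ τⁿ e^{-τ} Re ∏_μ T^{g_μ}_m(τ/d, β/d) dτ)/(2π)^d`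
  (the `w = 1` case is `srwTwist_succ_one_single_eq_integral_axisTransform` of `SrwTwistBesselRow.lean`);
* `norm_prod_add_sub_prod_le_of_norm_le`, `abs_re_prod_add_sub_re_prod_le` — the product-perturbation inequality
  `|Re ∏(a_i + r_i) − Re ∏ a_i| ≤ ∏(‖a_i‖ + ρ_i) − ∏‖a_i‖` (`‖r_i‖ ≤ ρ_i`), the unequal-factor version
  of `abs_re_add_pow_sub_re_pow_le_of_norm_le` (`SrwTwistRowOrderBall.lean`): the truncation budget of
  a weighted slice, row by row.

Everything is PROVED (standard axioms), d-generic and number-free; no definition, no named fact.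
Epistemic status / lane: what-if / input-certification SUPPORT (glue between the weighted consumer
interface and the inserted-row kernel inputs); nothing here is a certificate; no statement at a specific
dimension.

## References
* R. Fitzner, R. van der Hofstad, PTRF 169 (2017) 1041–1119, (3.34)–(3.38) p. 1071, §5.1.1 (5.2)–(5.5),
  (5.9) p. 1092. [FitznerVanDerHofstad2016NoBLE]
* NIST DLMF §10.32.1, §10.35.2. [DLMF]
-/

noncomputable section

open MeasureTheory Set Filter Real
open scoped Topology Nat

namespace Literature.Probability.FitznerVanDerHofstad2017

open Literature.Barriers.CriticalPhenomena
open Literature.Barriers.CriticalPhenomena.Slade2006Prop53 (μI P)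

variable {d : ℕ}

/-! ### Linearity in the weight -/

/-- **`srwTwist` is linear in the weight**: for finitely many bounded measurable weights `w_i` and real
coefficients `c_i` (`d ≥ 2n + 1`),
`Tw_n[Σ_i c_i w_i](x; β) = Σ_i c_i Tw_n[w_i](x; β)`.
[cite: FitznerVanDerHofstad2016NoBLE, (3.34)–(3.36) p. 1071; (5.9) p. 1092] -/
theorem srwTwist_sum_weight {ι : Type*} (s : Finset ι) (c : ι → ℝ) (w : ι → (Fin d → ℝ) → ℝ)
    {n : ℕ} (hd : 2 * n + 1 ≤ d) (hwm : ∀ i ∈ s, Measurable (w i))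
    (hwb : ∀ i ∈ s, ∃ C : ℝ, ∀ k, |w i k| ≤ C) (x : Fin d → ℤ) (β : ℝ) :
    srwTwist d n (fun k => ∑ i ∈ s, c i * w i k) x β = ∑ i ∈ s, c i * srwTwist d n (w i) x β := by
  unfold srwTwist
  have hint : ∀ i ∈ s, Integrable (fun k => c i * ((w i k * Real.cos (β * DhatSym d x k))
      * Chat d 1 k ^ n)) (P d) := by
    intro i hi
    obtain ⟨C, hC⟩ := hwb i hi
    exact (integrable_weight_cos_mul_Chat_pow hd (hwm i hi) hC x β).const_mul (c i)
  have hptw : (fun k : Fin d → ℝ => ((∑ i ∈ s, c i * w i k) * Real.cos (β * DhatSym d x k))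
      * Chat d 1 k ^ n)
      = fun k => ∑ i ∈ s, c i * ((w i k * Real.cos (β * DhatSym d x k)) * Chat d 1 k ^ n) := by
    funext k
    rw [Finset.sum_mul, Finset.sum_mul]
    refine Finset.sum_congr rfl fun i _ => ?_
    ring
  rw [hptw, integral_finsetSum s hint, Finset.sum_div]
  refine Finset.sum_congr rfl fun i _ => ?_
  rw [integral_const_mul, mul_div_assoc]

/-! ### Fubini on the cube with a product weight -/

/-- `τ D̂(k) = Σ_j (τ/d) cos k_j` (plumbing). [cite: FitznerVanDerHofstad2016NoBLE, (3.36) p. 1071] -/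
private theorem mul_Dhat_eq_sum' (τ : ℝ) (k : Fin d → ℝ) :
    τ * Dhat d k = ∑ j, τ / d * Real.cos (k j) := by
  simp only [Dhat]
  rw [mul_div_assoc', Finset.mul_sum, Finset.sum_div]
  exact Finset.sum_congr rfl fun j _ => by ring


/-- **Product weight, complex form**: for continuous one-coordinate weights `f_μ`,
`∫ (∏_μ f_μ(k_μ)) e^{τD̂(k) + iβ Σ_j cos(m k_j)} dk = ∏_μ ∫_{[-π,π]} f_μ(t) e^{(τ/d) cos t + iβ cos(mt)} dt`.
[cite: FitznerVanDerHofstad2016NoBLE, §5.1.1 (5.2)–(5.4)] -/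
theorem integral_prod_mul_cexp_Dhat_add_P (f : Fin d → ℝ → ℂ) (τ β : ℝ) (m : ℤ) :
    ∫ k, (∏ μ, f μ (k μ)) * Complex.exp (((τ * Dhat d k : ℝ) : ℂ)
        + ((β * ∑ j, Real.cos (m * k j) : ℝ) : ℂ) * Complex.I) ∂P d
      = ∏ μ, ∫ t, f μ t * Complex.exp (((τ / d * Real.cos t : ℝ) : ℂ)
          + ((β * Real.cos (m * t) : ℝ) : ℂ) * Complex.I) ∂μI := by
  have h : ∀ k : Fin d → ℝ,
      (∏ μ, f μ (k μ)) * Complex.exp (((τ * Dhat d k : ℝ) : ℂ)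
          + ((β * ∑ j, Real.cos (m * k j) : ℝ) : ℂ) * Complex.I)
        = ∏ μ, (f μ (k μ) * Complex.exp (((τ / d * Real.cos (k μ) : ℝ) : ℂ)
            + ((β * Real.cos (m * k μ) : ℝ) : ℂ) * Complex.I)) := by
    intro k
    rw [Finset.prod_mul_distrib, ← Complex.exp_sum, mul_Dhat_eq_sum', Finset.mul_sum]
    push_cast
    rw [Finset.sum_mul, ← Finset.sum_add_distrib]
  simp_rw [h]
  rw [show P d = Measure.pi (fun _ : Fin d => μI) from rfl,
    integral_fintype_prod_eq_prod (𝕜 := ℂ) (fun (μ : Fin d) (t : ℝ) =>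
      f μ t * Complex.exp (((τ / d * Real.cos t : ℝ) : ℂ) + ((β * Real.cos (m * t) : ℝ) : ℂ) * Complex.I))]

/-- Bounded continuous functions are integrable against a finite measure (plumbing).
[cite: FitznerVanDerHofstad2016NoBLE, §5.1.1 (5.2)–(5.4)] -/
private lemma integrable_of_continuous_of_bound' {α : Type*} [MeasurableSpace α]
    [TopologicalSpace α] [OpensMeasurableSpace α] (μ : Measure α) [IsFiniteMeasure μ]
    {E : Type*} [NormedAddCommGroup E] [SecondCountableTopologyEither α E] {f : α → E}
    (hf : Continuous f) (C : ℝ) (hC : ∀ x, ‖f x‖ ≤ C) : Integrable f μ :=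
  (integrable_const C).mono' hf.aestronglyMeasurable (ae_of_all _ hC)

/-- **Product weight, real form**: for continuous bounded real one-coordinate weights `g_μ`,
`∫ (∏_μ g_μ(k_μ)) e^{τD̂(k)} cos(β Σ_j cos(m k_j)) dk = Re ∏_μ ∫_{[-π,π]} g_μ(t) e^{(τ/d) cos t + iβ cos(mt)} dt`.
[cite: FitznerVanDerHofstad2016NoBLE, §5.1.1 (5.2)–(5.4)] -/
theorem integral_prod_mul_exp_Dhat_mul_cos_P (g : Fin d → ℝ → ℝ) (hg : ∀ μ, Continuous (g μ))
    {C : ℝ} (hC : ∀ μ t, |g μ t| ≤ C) (τ β : ℝ) (m : ℤ) :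
    ∫ k, (∏ μ, g μ (k μ)) * (Real.exp (τ * Dhat d k) * Real.cos (β * ∑ j, Real.cos (m * k j))) ∂P d
      = (∏ μ, ∫ t, (g μ t : ℂ) * Complex.exp (((τ / d * Real.cos t : ℝ) : ℂ)
          + ((β * Real.cos (m * t) : ℝ) : ℂ) * Complex.I) ∂μI).re := by
  set G : (Fin d → ℝ) → ℂ := fun k => (∏ μ, ((g μ (k μ) : ℝ) : ℂ)) * Complex.exp (((τ * Dhat d k : ℝ) : ℂ)
      + ((β * ∑ j, Real.cos (m * k j) : ℝ) : ℂ) * Complex.I) with hGdef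
  have hgc : ∀ μ, Continuous (fun k : Fin d → ℝ => ((g μ (k μ) : ℝ) : ℂ)) := fun μ =>
    Complex.continuous_ofReal.comp ((hg μ).comp (continuous_apply μ))
  have hGc : Continuous G := by
    have := continuous_Dhat d
    have hp : Continuous (fun k : Fin d → ℝ => ∏ μ, ((g μ (k μ) : ℝ) : ℂ)) :=
      continuous_finsetProd _ (fun μ _ => hgc μ)
    simp only [hGdef]
    fun_prop
  have hGn : ∀ k, ‖G k‖ ≤ |C| ^ d * Real.exp |τ| := by
    intro k
    simp only [hGdef]
    rw [norm_mul, norm_prod, Complex.norm_exp, Complex.add_re, Complex.ofReal_re,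
      Complex.re_ofReal_mul, Complex.I_re, mul_zero, add_zero]
    refine mul_le_mul ?_ ?_ (Real.exp_pos _).le (by positivity)
    · calc ∏ μ, ‖((g μ (k μ) : ℝ) : ℂ)‖ ≤ ∏ _μ : Fin d, |C| :=
            Finset.prod_le_prod (fun _ _ => norm_nonneg _) (fun μ _ => by
              rw [Complex.norm_real, Real.norm_eq_abs]; exact (hC μ _).trans (le_abs_self C))
        _ = |C| ^ d := by rw [Finset.prod_const, Finset.card_univ, Fintype.card_fin]
    · exact Real.exp_le_exp.2 ((le_abs_self _).trans (by
        rw [abs_mul]; exact mul_le_of_le_one_right (abs_nonneg _) (abs_Dhat_le_one k)))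
  have hint : Integrable G (P d) := integrable_of_continuous_of_bound' (P d) hGc _ hGn
  have h2 : (fun k : Fin d → ℝ => (∏ μ, g μ (k μ))
      * (Real.exp (τ * Dhat d k) * Real.cos (β * ∑ j, Real.cos (m * k j))))
      = fun k => RCLike.re (G k) := by
    funext k
    simp only [hGdef]
    rw [RCLike.re_to_complex, ← Complex.ofReal_prod, Complex.re_ofReal_mul, Complex.exp_re,
      Complex.add_re, Complex.ofReal_re, Complex.re_ofReal_mul, Complex.I_re, mul_zero, add_zero,
      Complex.add_im, Complex.ofReal_im, Complex.im_ofReal_mul, Complex.I_im, mul_one, zero_add]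
  rw [h2, integral_re hint, RCLike.re_to_complex]
  simp only [hGdef]
  rw [integral_prod_mul_cexp_Dhat_add_P (fun μ t => ((g μ t : ℝ) : ℂ)) τ β m]

/-! ### The Schwinger / axis-transform form of a product-weighted twisted seed -/

/-- **Product-weighted twisted seed at an axis node.** For `d ≥ 2n + 3`, an axis `i`, `m : ℤ`, and
continuous one-coordinate weights with `|g_μ| ≤ 1`,
`Tw_{n+1}[∏_μ g_μ(k_μ)](m e_i; β) = (n!)⁻¹ (∫₀^∞ τⁿ e^{-τ} Re ∏_μ T^{g_μ}_m(τ/d, β/d) dτ)/(2π)^d`,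
`T^{g}_m(v,y) = ∫_{[-π,π]} g(t) e^{v cos t + iy cos(mt)} dt` (the twist `β D̂^{(m e_i)}_sym = (β/d) Σ_j cos(m k_j)`
is a sum over coordinates, so the cube integral factorises after the Schwinger step).
[cite: FitznerVanDerHofstad2016NoBLE, (3.34)–(3.36) p. 1071; FitznerVanDerHofstad2016NoBLE, §5.1.1 (5.2)–(5.4)] -/
theorem srwTwist_succ_prod_single_eq_integral (n : ℕ) (hd : 2 * (n + 1) + 1 ≤ d) (i : Fin d) (m : ℤ)
    (β : ℝ) (g : Fin d → ℝ → ℝ) (hg : ∀ μ, Continuous (g μ)) (hg1 : ∀ μ t, |g μ t| ≤ 1) :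
    srwTwist d (n + 1) (fun k => ∏ μ, g μ (k μ)) (Pi.single i m) β
      = (n ! : ℝ)⁻¹ * (∫ τ in Ioi (0:ℝ), τ ^ n * (Real.exp (-τ) *
          (∏ μ, ∫ t, (g μ t : ℂ) * Complex.exp (((τ / d * Real.cos t : ℝ) : ℂ)
              + ((β / d * Real.cos (m * t) : ℝ) : ℂ) * Complex.I) ∂μI).re)) / (2 * π) ^ d := by
  have hd0 : (d : ℝ) ≠ 0 := by
    have : 0 < d := by omega
    positivity
  have hph : ∀ k : Fin d → ℝ, β * DhatSym d (Pi.single i m) k = β / d * ∑ j, Real.cos (m * k j) := by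
    intro k
    rw [← natCast_mul_DhatSym_single_intCast i m k]
    field_simp
  have hgc : ∀ μ, Continuous (fun k : Fin d → ℝ => g μ (k μ)) := fun μ =>
    (hg μ).comp (continuous_apply μ)
  have hp : Continuous (fun k : Fin d → ℝ => ∏ μ, g μ (k μ)) :=
    continuous_finsetProd _ (fun μ _ => hgc μ)
  have hWm : Measurable fun k : Fin d → ℝ =>
      (∏ μ, g μ (k μ)) * Real.cos (β * DhatSym d (Pi.single i m) k) := by
    have := continuous_DhatSym d (Pi.single i m)
    exact Continuous.measurable (by fun_prop)
  have hW1 : ∀ k : Fin d → ℝ, |(∏ μ, g μ (k μ)) * Real.cos (β * DhatSym d (Pi.single i m) k)| ≤ 1 := by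
    intro k
    rw [abs_mul, Finset.abs_prod]
    exact mul_le_one₀ (Finset.prod_le_one (fun _ _ => abs_nonneg _) (fun μ _ => hg1 μ _))
      (abs_nonneg _) (Real.abs_cos_le_one _)
  unfold srwTwist
  rw [integral_mul_Chat_pow_succ_eq_integral_Ioi_of_bdd n hd hWm hW1]
  congr 1
  congr 1
  refine setIntegral_congr_fun measurableSet_Ioi fun τ _ => ?_
  congr 1
  have hexp : ∀ k : Fin d → ℝ, Real.exp (-((1 - Dhat d k) * τ))
      = Real.exp (-τ) * Real.exp (τ * Dhat d k) := by
    intro k; rw [← Real.exp_add]; congr 1; ring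
  simp_rw [hph, hexp]
  calc ∫ k, (∏ μ, g μ (k μ)) * Real.cos (β / d * ∑ j, Real.cos (m * k j))
        * (Real.exp (-τ) * Real.exp (τ * Dhat d k)) ∂P d
      = Real.exp (-τ) * ∫ k, (∏ μ, g μ (k μ))
          * (Real.exp (τ * Dhat d k) * Real.cos (β / d * ∑ j, Real.cos (m * k j))) ∂P d := by
        rw [← integral_const_mul]
        congr 1
        funext k
        ring
    _ = Real.exp (-τ) * (∏ μ, ∫ t, (g μ t : ℂ) * Complex.exp (((τ / d * Real.cos t : ℝ) : ℂ)
          + ((β / d * Real.cos (m * t) : ℝ) : ℂ) * Complex.I) ∂μI).re := by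
        rw [integral_prod_mul_exp_Dhat_mul_cos_P g hg hg1 τ (β / d) m]

/-! ### Perturbation of a product (the truncation budget of a weighted slice) -/

/-- **Product perturbation**: `‖∏_i (a_i + r_i) − ∏_i a_i‖ ≤ ∏_i (‖a_i‖ + ρ_i) − ∏_i ‖a_i‖` whenever
`‖r_i‖ ≤ ρ_i` (telescoping; the unequal-factor version of `norm_add_pow_sub_pow_le`; cf. the majorised
form `Literature.NumberTheory.Sieve.norm_prod_add_sub_prod_le` of `SmoothMajorantAssembly.lean`): replacing
each inserted row by its truncation costs the difference of the two products of row norms.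
[cite: FitznerVanDerHofstad2016NoBLE, §5.1.1 (5.2)–(5.5)] -/
theorem norm_prod_add_sub_prod_le_of_norm_le {ι : Type*} (s : Finset ι) (a r : ι → ℂ) (ρ : ι → ℝ)
    (hr : ∀ i ∈ s, ‖r i‖ ≤ ρ i) :
    ‖∏ i ∈ s, (a i + r i) - ∏ i ∈ s, a i‖ ≤ ∏ i ∈ s, (‖a i‖ + ρ i) - ∏ i ∈ s, ‖a i‖ := by
  classical
  induction s using Finset.induction_on with
  | empty => simp
  | insert j s hj ih =>
    have hr' : ∀ i ∈ s, ‖r i‖ ≤ ρ i := fun i hi => hr i (Finset.mem_insert_of_mem hi)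
    have hj' : ‖r j‖ ≤ ρ j := hr j (Finset.mem_insert_self j s)
    have ih' := ih hr'
    rw [Finset.prod_insert hj, Finset.prod_insert hj, Finset.prod_insert hj, Finset.prod_insert hj]
    set X' := ∏ i ∈ s, (a i + r i) with hX'
    set X := ∏ i ∈ s, a i with hX
    set P' := ∏ i ∈ s, (‖a i‖ + ρ i) with hP'
    have hXn : ‖X‖ = ∏ i ∈ s, ‖a i‖ := by rw [hX, norm_prod]
    have hPX : ‖X‖ ≤ P' := by
      have := ih'; rw [← hXn] at this; linarith [norm_nonneg (X' - X)]
    have haj : ‖a j + r j‖ ≤ ‖a j‖ + ρ j := (norm_add_le _ _).trans (by linarith)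
    have hρj : 0 ≤ ρ j := (norm_nonneg _).trans hj'
    calc ‖(a j + r j) * X' - a j * X‖
        = ‖(a j + r j) * (X' - X) + r j * X‖ := by ring_nf
      _ ≤ ‖a j + r j‖ * ‖X' - X‖ + ‖r j‖ * ‖X‖ := by
          refine (norm_add_le _ _).trans ?_
          rw [norm_mul, norm_mul]
      _ ≤ (‖a j‖ + ρ j) * (P' - ∏ i ∈ s, ‖a i‖) + ρ j * ‖X‖ := by
          gcongr
      _ = (‖a j‖ + ρ j) * P' - ‖a j‖ * ∏ i ∈ s, ‖a i‖ := by rw [hXn]; ring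

/-- Real parts: `|Re ∏_i (a_i + r_i) − Re ∏_i a_i| ≤ ∏_i (‖a_i‖ + ρ_i) − ∏_i ‖a_i‖` (`‖r_i‖ ≤ ρ_i`).
[cite: FitznerVanDerHofstad2016NoBLE, §5.1.1 (5.2)–(5.5)] -/
theorem abs_re_prod_add_sub_re_prod_le {ι : Type*} (s : Finset ι) (a r : ι → ℂ) (ρ : ι → ℝ)
    (hr : ∀ i ∈ s, ‖r i‖ ≤ ρ i) :
    |(∏ i ∈ s, (a i + r i)).re - (∏ i ∈ s, a i).re| ≤ ∏ i ∈ s, (‖a i‖ + ρ i) - ∏ i ∈ s, ‖a i‖ := by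
  rw [← Complex.sub_re]
  exact (Complex.abs_re_le_norm _).trans (norm_prod_add_sub_prod_le_of_norm_le s a r ρ hr)

end Literature.Probability.FitznerVanDerHofstad2017
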